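import Summits.CriticalPhenomena.PercolationContinuityZ3.Theorems.PercNearOneGluingNoHeavyLowerTailStarSetPoolTools
import HarnessLib

/-!
# `NoHeavyLowerTail` (stmt-CriticalPhenomena-4575) — demand of the partner-group pool entries, weak hub hypothesis

Support file (prover `prim-gen-swap` gen 15; `--supports stmt-CriticalPhenomena-4575`).  No definitions, no named facts, no sorries.

`StarSet.pool_demand_groups'` is `StarSet.pool_demand_groups` (file `…StarSetPoolDemand`) with the hub hypothesis `X ≠ I₀` required only
for FLAGGED entries (those whose configurations may contain the leaf class `I₀`).  This is the form used by `StarSet.pool_bound`: when the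
forest has no leaf class at `r` there are no flagged entries and no `I₀`-group, and the role of `I₀` in the pool bound is played by an arbitrary hub.
-/

namespace Summit.CriticalPhenomena.PercolationContinuityZ3.Theorems

open Finset
open scoped BigOperators

namespace StarSet

variable {ι : Type*} [Fintype ι] [LinearOrder ι]

/-- **Demand of the partner-group entries** (`X ≠ I₀` only for flagged entries): `Σ W ≤ Σ_J Σ_X E₀ t_X t_J (1 + T·[flag])`. -/
theorem pool_demand_groups' (θ : ι → ℝ) (hθ0 : ∀ k, 0 ≤ θ k) (hθ1 : ∀ k, θ k < 1) (Pool : Finset ι) (I₀ : ι) (hI₀ : I₀ ∉ Pool)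
    (Js : Finset ι) (hJs : ∀ J ∈ Js, J ∉ Pool ∧ J ≠ I₀)
    (fl : ι → ι → Prop) [∀ J, DecidablePred (fl J)]
    (𝒳 : ι → Finset ι) (h𝒳 : ∀ J ∈ Js, ∀ X ∈ 𝒳 J, X ∉ Pool ∧ X ≠ J ∧ (fl J X → X ≠ I₀))
    (Ug : Finset (Finset ι × ι)) (Jof : Finset ι × ι → ι)
    (hUg : ∀ u ∈ Ug, Jof u ∈ Js ∧ u.2 ∈ 𝒳 (Jof u) ∧ u.2 ∈ u.1 ∧ Jof u ∈ u.1 ∧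
      ∀ K ∈ u.1, K ≠ u.2 → K ≠ Jof u → (K ∈ Pool ∨ (fl (Jof u) u.2 ∧ K = I₀))) :
    ∑ u ∈ Ug, ((∏ k ∈ u.1, θ k) * ∏ k ∈ univ \ u.1, (1 - θ k)) ≤
      ∑ J ∈ Js, ∑ X ∈ 𝒳 J, (∏ k ∈ univ \ Pool, (1 - θ k)) *
        (θ X / (1 - θ X) * (θ J / (1 - θ J)) * (1 + if fl J X then θ I₀ / (1 - θ I₀) else 0)) := by
  classical
  set t : ι → ℝ := fun V => θ V / (1 - θ V) with ht
  set E₀ := ∏ k ∈ univ \ Pool, (1 - θ k) with hE₀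
  set W : Finset ι → ℝ := fun S => (∏ k ∈ S, θ k) * ∏ k ∈ univ \ S, (1 - θ k) with hW
  set T := t I₀ with hT
  have ht0 : ∀ V, 0 ≤ t V := fun V => div_nonneg (hθ0 V) (by linarith [hθ1 V])
  -- pool credit with `I₀` allowed: `Π_{V ∉ Pool ∪ {I₀}}(1 − θ) = E₀ (1 + T)`
  have hE₀I : ∏ k ∈ univ \ insert I₀ Pool, (1 - θ k) = E₀ * (1 + T) := by
    have hsplit : univ \ Pool = insert I₀ (univ \ insert I₀ Pool) := by
      ext k
      simp only [mem_sdiff, mem_univ, true_and, mem_insert]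
      constructor
      · intro hk; by_cases h : k = I₀; · exact Or.inl h
        · exact Or.inr (not_or.2 ⟨h, hk⟩)
      · rintro (rfl | hk); · exact hI₀
        · exact fun h => hk (Or.inr h)
    have hnot : I₀ ∉ univ \ insert I₀ Pool := fun h => (mem_sdiff.1 h).2 (mem_insert_self _ _)
    have h1 : 1 - θ I₀ ≠ 0 := by linarith [hθ1 I₀]
    rw [hE₀, hsplit, prod_insert hnot, hT, ht]
    field_simp
    ring
  set demg : ι → ι → ℝ := fun J X => E₀ * (t X * t J * (1 + if fl J X then T else 0)) with hdemg
  show ∑ u ∈ Ug, W u.1 ≤ ∑ J ∈ Js, ∑ X ∈ 𝒳 J, demg J X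
  set Eidx := (Js ×ˢ (univ : Finset ι)).filter (fun p => p.2 ∈ 𝒳 p.1) with hEidx
  have hmaps : ∀ u ∈ Ug, (Jof u, u.2) ∈ Eidx := fun u hu =>
    mem_filter.2 ⟨mem_product.2 ⟨(hUg u hu).1, mem_univ _⟩, (hUg u hu).2.1⟩
  rw [← sum_fiberwise_of_maps_to hmaps]
  have hE : ∑ J ∈ Js, ∑ X ∈ 𝒳 J, demg J X = ∑ p ∈ Eidx, demg p.1 p.2 :=
    (sum_finset_product (f := fun p : ι × ι => demg p.1 p.2) Eidx Js 𝒳 (fun q => by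
      simp only [hEidx, mem_filter, mem_product, mem_univ, and_true])).symm
  rw [hE]
  refine sum_le_sum fun p hp => ?_
  obtain ⟨hp1, hp2⟩ := mem_filter.1 hp
  have hJ : p.1 ∈ Js := (mem_product.1 hp1).1
  obtain ⟨hXP, hXJ, hXI⟩ := h𝒳 p.1 hJ p.2 hp2
  obtain ⟨hJP, hJI⟩ := hJs p.1 hJ
  -- the allowed rider set
  set Pl := if fl p.1 p.2 then insert I₀ Pool else Pool with hPl
  have hO : Disjoint ({p.2, p.1} : Finset ι) Pl := by
    rw [disjoint_left]
    intro k hk hk'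
    rcases mem_insert.1 hk with rfl | hk
    · simp only [hPl] at hk'
      split_ifs at hk' with h
      · rcases mem_insert.1 hk' with h' | h'
        · exact hXI h h'
        · exact hXP h'
      · exact hXP hk'
    · rw [mem_singleton.1 hk] at hk'
      simp only [hPl] at hk'
      split_ifs at hk' with h
      · rcases mem_insert.1 hk' with h' | h'
        · exact hJI h'
        · exact hJP h'
      · exact hJP hk'
  have hle := units_load_le_cylinder_pool θ hθ0 hθ1 Pl {p.2, p.1} hO (Ug.filter (fun u => (Jof u, u.2) = p))
    (fun u hu => by
      obtain ⟨huU, hup⟩ := mem_filter.1 hu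
      obtain ⟨-, -, hXS, hJS, hrest⟩ := hUg u huU
      have h2 : u.2 = p.2 := (congrArg Prod.snd hup :)
      have h1 : Jof u = p.1 := (congrArg Prod.fst hup :)
      refine ⟨?_, fun k hk hkO => ?_⟩
      · intro k hk
        rcases mem_insert.1 hk with rfl | hk
        · rw [← h2]; exact hXS
        · rw [mem_singleton.1 hk, ← h1]; exact hJS
      · have hkX : k ≠ u.2 := fun h => hkO (by rw [h, h2]; exact mem_insert_self _ _)
        have hkJ : k ≠ Jof u := fun h => hkO (by rw [h, h1]; exact mem_insert_of_mem (mem_singleton_self _))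
        rcases hrest k hk hkX hkJ with h | ⟨hfl, rfl⟩
        · simp only [hPl]; split_ifs
          · exact mem_insert_of_mem h
          · exact h
        · rw [h1, h2] at hfl
          simp only [hPl, if_pos hfl]
          exact mem_insert_self _ _)
    (fun u hu v hv huv => by
      have h2u : u.2 = p.2 := (congrArg Prod.snd (mem_filter.1 hu).2 :)
      have h2v : v.2 = p.2 := (congrArg Prod.snd (mem_filter.1 hv).2 :)
      exact Prod.ext huv (h2u.trans h2v.symm))
  refine hle.trans (le_of_eq ?_)
  rw [prod_pair (Ne.symm hXJ).symm]
  simp only [hdemg, hPl]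
  split_ifs with h
  · rw [hE₀I]; ring
  · simp only [hE₀]; ring

end StarSet

end Summit.CriticalPhenomena.PercolationContinuityZ3.Theorems
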